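import Literature.MathematicalPhysics.QuantumFieldTheory.Balaban1983to89.T4TrajectoryDensity
import Literature.MathematicalPhysics.QuantumFieldTheory.Balaban1983to89.T4BlockTransport

/-!
# Node N14 = NE1′ — DRESSING A WEIGHT SLICE: the observable-attached weight family `ω_U · e^{τ·G_U}` is again a weight slice,
# with the exponent margin `s ↦ s + l₀·B`; hence the DRESSED normalised complex-weight operation is an `OpSliceOn` with constant
# `e^{3(s + l₀B)}` under the load-bearing smallness `s + l₀·B ≤ 1` (the (w2-act) margin the observable consumes, in kernel)

Cell `pub-ymgap`, HUMAN RULING D-0062 (Track A at full width), seat `pub-ymgap-dag-n14-a` (-a KNIT-BY-NAME of N14 = NE1′); venue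
`Summits/QuantumFields/YangMills/Theorems/` (R424), namespace `YMDAG.N14`; THEOREMS ONLY; imports `T4TrajectoryDensity` only.
Complements (does NOT restate) the measure-level tilted (1.73)ₜ–(1.75)ₜ ∕ covariance module of record `B16Ineq175Tilted.lean`
(dag-n14-b, p409237; dag-lead DEDUP word pub-ymgap INBOX l.9048): this file works one level up, at the SLICE binder END-F of the
NE1′ booking road consumes (`T4TrajectoryDensity.WeightSlice` → `opSliceOn_wOp` → `OpSliceOn`), where no tilted-mean statement occurs.

WHAT.  The -b walk of N14 (pub-ymgap INBOX l.8935 ∕ l.8954) records that at [Balaban1989LargeFieldII] (1.73)–(1.75) p. 380 the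
observable-attached instance «σ ↦ σ + τ·W» is a SUBSTITUTION.  Here the substitution is a kernel theorem AT THE SLICE LEVEL: for a
weight family `ω : 𝒰 → Z → ℂ` with a weight slice of exponent margin `s` (window `𝒦`, directions of size `≤ w`, disc radius `ϱ`),
a complex source `τ` with `‖τ‖ ≤ l₀`, and an observable `G : 𝒰 → Z → ℂ` which along every admissible slice is a.e.-measurable,
holomorphic in the slice parameter and bounded by `B` on an open set containing the closed discs of radius `ϱ ∕ N d` about `[0,1]`
(an INLINE hypothesis shape — e.g. a Wilson loop of the affinely moved configuration, polynomial in the slice parameter; NOT asserted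
for Bałaban's objects):
* `weightSlice_dressed` — the DRESSED family `U ↦ ω_U · e^{τ·G_U}` has `WeightSlice … (s + l₀·B)`: same `t`-independent density
  `ρ₀` (so the positive mass (1.74) needs is untouched), exponent `σ_t + τ·G(move U₀ d t)`, on the intersection of the two open sets;
* `opSliceOn_wOp_dressed` — hence, under `s + l₀·B ≤ 1`, the dressed normalised operation `wOp (ω·e^{τG}) μ z₀` is an
  `OpSliceOn (BddClass F μ) … (e^{3(s + l₀B)})` (`opSliceOn_wOp` BY NAME): holomorphic along slices and bounded by
  `e^{3(s+l₀B)}·m` — (1.73)–(1.75) WITH THE OBSERVABLE ATTACHED, uniformly in `‖τ‖ ≤ l₀`; `dressed_zero` (τ = 0 is undressed);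
* `weightSlice_dressed_of_exponentSliceAt` ∕ `opSliceOn_wOp_expAt_dressed` — the same from END-F's (w2-act) binder PAIR
  `RealBaseAt ref base 𝒜` + `ExponentSliceAt ref 𝒜 … s` (printed TYPE (1.65) p. 375 ∕ (1.71)–(1.75) pp. 379–380 of the ACTION
  exponent): reality is asked of `𝒜` at the reference ONLY — the complex dressing `τ·G` sits in the slice exponent, never in `ρ₀`;
* DECIDED INSTANCE on the lattice chart `T4BlockTransport.latMove`∕`latN`: `differentiable_wordProd`, `norm_wordProd_le`,
  **`wilsonWord_alongSlices`** — a WILSON WORD `U ↦ φ(∏_{b ∈ bs} U b)` (ordered product of bond variables through a functional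
  `φ : R →L[ℂ] ℂ`) inhabits the observable hypothesis along every admissible slice of a bond-wise bounded window, with
  `B = ‖φ‖·‖1‖·(u + 2w + ϱ)^{|bs|}` on `{t | ‖t‖ < 2 + ϱ∕latN p}`; `weightSlice_dressed_wilsonWord` — the dressed weight slice for it.
The margin bookkeeping `s + l₀·B` is the function-level form of «the dressing rides inside the class with a bounded t-factor»
(BALABAN-GAPS §C l.46); the smallness `s + l₀B ≤ 1` is where the source window `l₀` is CONSUMED against (w2-act)'s margin.

HONEST FRAMING.  [folklore] measure theory ∕ complex calculus over hypothesis SHAPES; nothing of Bałaban's densities or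
observables is asserted or instantiated; NE1′ NOT printed ([B16] p. 356 ll. 1–6), NOT proved; NOT a discharge of N14 (statement of
record `NE1p.DressedRoot.DressedStabilityStrict` = booking-level class over an unconstructed run, OBJECT-bound); count-neutral.  One
finite T⁴ at fixed ε — NOT ℝ⁴, NOT OS, NOT a mass gap, NOT Clay.
-/

namespace YMDAG.N14

open MeasureTheory Set Metric Filter
open scoped Topology
open Literature.MathematicalPhysics.QuantumFieldTheory.Balaban1983to89.T4TrajectoryDensity
open Literature.MathematicalPhysics.QuantumFieldTheory.Balaban1983to89.T4TrajectoryModulus (OpSliceOn)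

noncomputable section

section Dress

variable {Z : Type*} [MeasurableSpace Z] {𝒰 Dir : Type*} {μ : Measure Z}
  {ω : 𝒰 → Z → ℂ} {G : 𝒰 → Z → ℂ} {move : 𝒰 → Dir → ℂ → 𝒰} {N : Dir → ℝ} {𝒦 : Set 𝒰} {w ϱ s l₀ B : ℝ} {τ : ℂ}

omit [MeasurableSpace Z] in
/-- Pointwise algebra of the dressing: `ρ₀e^{σ} · e^{τG} = ρ₀e^{σ + τG}`. [folklore] -/
theorem weight_mul_exp (ρ₀ : Z → ℝ) (σ g : Z → ℂ) (τ : ℂ) (z : Z) :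
    weight ρ₀ σ z * Complex.exp (τ * g z) = weight ρ₀ (fun z => σ z + τ * g z) z := by
  rw [weight_apply, weight_apply, mul_assoc, ← Complex.exp_add]

/-- **DRESSING A WEIGHT SLICE** [folklore]: a weight slice of exponent margin `s` for `ω`, a source `‖τ‖ ≤ l₀`, and an observable
`G` a.e.-measurable, holomorphic and bounded by `B` along every admissible slice (on an open set containing the closed discs of
radius `ϱ ∕ N d` about `[0,1]`) give a weight slice of margin `s + l₀·B` for the DRESSED family `U ↦ ω_U · e^{τ·G_U}` — same
`t`-independent density `ρ₀`, exponent `σ_t + τ·G(move U₀ d t)`. -/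
theorem weightSlice_dressed (hws : WeightSlice ω μ move N 𝒦 w ϱ s) (hτ : ‖τ‖ ≤ l₀)
    (hG : ∀ U₀ ∈ 𝒦, ∀ d : Dir, 0 < N d → N d ≤ w →
      ∃ Ω' : Set ℂ, IsOpen Ω' ∧ (∀ x ∈ Icc (0 : ℝ) 1, closedBall (x : ℂ) (ϱ / N d) ⊆ Ω') ∧
        (∀ t ∈ Ω', AEStronglyMeasurable (G (move U₀ d t)) μ) ∧
        (∀ᵐ z ∂μ, DifferentiableOn ℂ (fun t => G (move U₀ d t) z) Ω') ∧
        (∀ᵐ z ∂μ, ∀ t ∈ Ω', ‖G (move U₀ d t) z‖ ≤ B)) :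
    WeightSlice (fun U z => ω U z * Complex.exp (τ * G U z)) μ move N 𝒦 w ϱ (s + l₀ * B) := by
  intro U₀ hU₀ d hd hdw
  obtain ⟨Ω, hΩ, hballs, ρ₀, hρ0, hρ, hP, σ, hσm, hσd, hσb, hfac⟩ := hws U₀ hU₀ d hd hdw
  obtain ⟨Ω', hΩ', hballs', hGm, hGd, hGb⟩ := hG U₀ hU₀ d hd hdw
  refine ⟨Ω ∩ Ω', hΩ.inter hΩ', fun x hx => subset_inter (hballs x hx) (hballs' x hx), ρ₀, hρ0, hρ, hP,
    fun t z => σ t z + τ * G (move U₀ d t) z, fun t ht => (hσm t ht.1).add (aestronglyMeasurable_const.mul (hGm t ht.2)),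
    ?_, ?_, fun t ht => ?_⟩
  · filter_upwards [hσd, hGd] with z hz hz'
    exact (hz.mono inter_subset_left).add ((hz'.mono inter_subset_right).const_mul τ)
  · filter_upwards [hσb, hGb] with z hz hz' t ht
    calc ‖σ t z + τ * G (move U₀ d t) z‖ ≤ ‖σ t z‖ + ‖τ * G (move U₀ d t) z‖ := norm_add_le _ _
      _ ≤ s + l₀ * B := by
          rw [norm_mul]
          exact add_le_add (hz t ht.1) (mul_le_mul hτ (hz' t ht.2) (norm_nonneg _) ((norm_nonneg _).trans hτ))
  · filter_upwards [hfac t ht.1] with z hz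
    show ω (move U₀ d t) z * Complex.exp (τ * G (move U₀ d t) z) = _
    rw [hz, weight_mul_exp]

/-- **END-F's (w2-act) BINDER PAIR, DRESSED** [folklore]: a real regular reference `RealBaseAt ref base 𝒜 μ 𝒦` and an exponent
slice `ExponentSliceAt ref 𝒜 μ move N 𝒦 w ϱ s` about it (the printed TYPE [Balaban1989LargeFieldII] (1.65) p. 375 ∕ (1.71)–(1.75)
pp. 379–380 of the ACTION exponent, END-F's `hB`∕`hE`), a source `‖τ‖ ≤ l₀` and an observable `G` along the slices give a weight
slice of margin `s + l₀·B` for the DRESSED exponent-form family `U ↦ (base·e^{−𝒜_U})·e^{τ·G_U}` — `weightSlice_of_exponentSliceAt`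
then `weightSlice_dressed`.  The reality of the reference exponent is asked of `𝒜` ONLY: the dressing `τ·G` (complex for complex
`τ`) sits entirely in the slice exponent `σ_t`, never in the density `ρ₀`. -/
theorem weightSlice_dressed_of_exponentSliceAt {ref : 𝒰 → 𝒰} {base : Z → ℝ} {𝒜 : 𝒰 → Z → ℂ}
    (hB : RealBaseAt ref base 𝒜 μ 𝒦) (hE : ExponentSliceAt ref 𝒜 μ move N 𝒦 w ϱ s) (hτ : ‖τ‖ ≤ l₀)
    (hG : ∀ U₀ ∈ 𝒦, ∀ d : Dir, 0 < N d → N d ≤ w →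
      ∃ Ω' : Set ℂ, IsOpen Ω' ∧ (∀ x ∈ Icc (0 : ℝ) 1, closedBall (x : ℂ) (ϱ / N d) ⊆ Ω') ∧
        (∀ t ∈ Ω', AEStronglyMeasurable (G (move U₀ d t)) μ) ∧
        (∀ᵐ z ∂μ, DifferentiableOn ℂ (fun t => G (move U₀ d t) z) Ω') ∧
        (∀ᵐ z ∂μ, ∀ t ∈ Ω', ‖G (move U₀ d t) z‖ ≤ B)) :
    WeightSlice (fun U z => expWeight base 𝒜 U z * Complex.exp (τ * G U z)) μ move N 𝒦 w ϱ (s + l₀ * B) :=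
  weightSlice_dressed (weightSlice_of_exponentSliceAt hB hE) hτ hG

variable {F : Type*} [NormedAddCommGroup F] [NormedSpace ℂ F]

/-- **THE DRESSED NORMALISED OPERATION IS AN `OpSliceOn`** [folklore]: under the LOAD-BEARING smallness `s + l₀·B ≤ 1` and a window
`D` of full measure, the normalised complex-weight operation of the DRESSED family, `wOp (ω·e^{τG}) μ z₀`, is holomorphic along
every admissible slice and bounded by `e^{3(s + l₀B)}·m` on integrands of the class with `‖h‖ ≤ m` on `D` — `opSliceOn_wOp` BY NAME
on `weightSlice_dressed`: (1.73)–(1.75) with the observable attached, uniformly in the source `‖τ‖ ≤ l₀`. -/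
theorem opSliceOn_wOp_dressed (z₀ : Z) (hws : WeightSlice ω μ move N 𝒦 w ϱ s) (hτ : ‖τ‖ ≤ l₀)
    (hG : ∀ U₀ ∈ 𝒦, ∀ d : Dir, 0 < N d → N d ≤ w →
      ∃ Ω' : Set ℂ, IsOpen Ω' ∧ (∀ x ∈ Icc (0 : ℝ) 1, closedBall (x : ℂ) (ϱ / N d) ⊆ Ω') ∧
        (∀ t ∈ Ω', AEStronglyMeasurable (G (move U₀ d t)) μ) ∧
        (∀ᵐ z ∂μ, DifferentiableOn ℂ (fun t => G (move U₀ d t) z) Ω') ∧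
        (∀ᵐ z ∂μ, ∀ t ∈ Ω', ‖G (move U₀ d t) z‖ ≤ B))
    (hsmall : s + l₀ * B ≤ 1) {D : Set Z} (hD : ∀ᵐ z ∂μ, z ∈ D) :
    OpSliceOn (BddClass F μ) (wOp (fun U z => ω U z * Complex.exp (τ * G U z)) μ z₀) D move N 𝒦 w ϱ
      (Real.exp (3 * (s + l₀ * B))) :=
  opSliceOn_wOp z₀ (weightSlice_dressed hws hτ hG) hsmall hD

/-- **THE DRESSED OPERATION FROM END-F's BINDER PAIR** [folklore]: `RealBaseAt` + `ExponentSliceAt` of margin `s` + a source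
`‖τ‖ ≤ l₀` + an observable along the slices + the smallness `s + l₀·B ≤ 1` ⇒ the normalised complex-weight operation of the
DRESSED exponent-form family is an `OpSliceOn (BddClass F μ) … (e^{3(s+l₀B)})` — `opSliceOn_wOp_expAt`'s dressed twin. -/
theorem opSliceOn_wOp_expAt_dressed {ref : 𝒰 → 𝒰} {base : Z → ℝ} {𝒜 : 𝒰 → Z → ℂ} (z₀ : Z)
    (hB : RealBaseAt ref base 𝒜 μ 𝒦) (hE : ExponentSliceAt ref 𝒜 μ move N 𝒦 w ϱ s) (hτ : ‖τ‖ ≤ l₀)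
    (hG : ∀ U₀ ∈ 𝒦, ∀ d : Dir, 0 < N d → N d ≤ w →
      ∃ Ω' : Set ℂ, IsOpen Ω' ∧ (∀ x ∈ Icc (0 : ℝ) 1, closedBall (x : ℂ) (ϱ / N d) ⊆ Ω') ∧
        (∀ t ∈ Ω', AEStronglyMeasurable (G (move U₀ d t)) μ) ∧
        (∀ᵐ z ∂μ, DifferentiableOn ℂ (fun t => G (move U₀ d t) z) Ω') ∧
        (∀ᵐ z ∂μ, ∀ t ∈ Ω', ‖G (move U₀ d t) z‖ ≤ B))
    (hsmall : s + l₀ * B ≤ 1) {D : Set Z} (hD : ∀ᵐ z ∂μ, z ∈ D) :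
    OpSliceOn (BddClass F μ) (wOp (fun U z => expWeight base 𝒜 U z * Complex.exp (τ * G U z)) μ z₀) D move N 𝒦 w ϱ
      (Real.exp (3 * (s + l₀ * B))) :=
  opSliceOn_wOp z₀ (weightSlice_dressed_of_exponentSliceAt hB hE hτ hG) hsmall hD

omit [MeasurableSpace Z] in
/-- The undressed case is recovered at `τ = 0` (the dressing factor is `1`). [folklore] -/
theorem dressed_zero (ω : 𝒰 → Z → ℂ) (G : 𝒰 → Z → ℂ) :
    (fun U z => ω U z * Complex.exp ((0 : ℂ) * G U z)) = ω := by
  funext U z; simp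

end Dress


/-! ## The observable hypothesis INHABITED on the lattice chart: Wilson words (decided instance) -/

section WilsonWord

open Literature.MathematicalPhysics.QuantumFieldTheory.Balaban1983to89.T4BlockTransport (Site Fld NDir latN latMove norm_dir_le)

variable {R : Type*} [NormedRing R] [NormedAlgebra ℂ R] {d : ℕ}

/-- A WILSON WORD along the affine lattice chart is a polynomial in the slice parameter, hence complex-differentiable everywhere:
`t ↦ ∏_{b ∈ bs} (U b + t·D b)` (ordered `List.prod`). [folklore] -/
theorem differentiable_wordProd (bs : List (Site d × Fin d)) (U : Fld d R) (p : NDir d R) :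
    Differentiable ℂ fun t : ℂ => (bs.map fun b => latMove U p t b.1 b.2).prod := by
  induction bs with
  | nil => simp
  | cons b bs ih =>
    simp only [List.map_cons, List.prod_cons]
    refine Differentiable.mul ?_ ih
    show Differentiable ℂ fun t : ℂ => U b.1 b.2 + t • p.1.1 b.1 b.2
    exact (differentiable_id.smul_const _).const_add _

/-- Norm of a Wilson word along the chart: with `‖U b‖ ≤ u` on every bond, `‖∏_{b ∈ bs} (U b + t·D b)‖ ≤ ‖1‖·(u + ‖t‖·latN p)^{|bs|}`
(sub-multiplicativity; the factor `‖(1 : R)‖` accounts for the empty word honestly). [folklore] -/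
theorem norm_wordProd_le (bs : List (Site d × Fin d)) {U : Fld d R} {u : ℝ}
    (hu : ∀ x ν, ‖U x ν‖ ≤ u) (p : NDir d R) (t : ℂ) :
    ‖(bs.map fun b => latMove U p t b.1 b.2).prod‖ ≤ ‖(1 : R)‖ * (u + ‖t‖ * latN p) ^ bs.length := by
  have hfac : ∀ b : Site d × Fin d, ‖latMove U p t b.1 b.2‖ ≤ u + ‖t‖ * latN p := fun b => by
    show ‖U b.1 b.2 + t • p.1.1 b.1 b.2‖ ≤ _
    calc ‖U b.1 b.2 + t • p.1.1 b.1 b.2‖ ≤ ‖U b.1 b.2‖ + ‖t • p.1.1 b.1 b.2‖ := norm_add_le _ _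
      _ ≤ u + ‖t‖ * latN p := by
          rw [norm_smul]
          exact add_le_add (hu _ _) (mul_le_mul_of_nonneg_left (norm_dir_le p _ _) (norm_nonneg _))
  induction bs with
  | nil => simp
  | cons b bs ih =>
    simp only [List.map_cons, List.prod_cons, List.length_cons, pow_succ]
    have hc0 : 0 ≤ u + ‖t‖ * latN p := (norm_nonneg _).trans (hfac b)
    calc ‖latMove U p t b.1 b.2 * (bs.map fun b => latMove U p t b.1 b.2).prod‖
        ≤ ‖latMove U p t b.1 b.2‖ * ‖(bs.map fun b => latMove U p t b.1 b.2).prod‖ := norm_mul_le _ _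
      _ ≤ (u + ‖t‖ * latN p) * (‖(1 : R)‖ * (u + ‖t‖ * latN p) ^ bs.length) :=
          mul_le_mul (hfac b) ih (norm_nonneg _) hc0
      _ = ‖(1 : R)‖ * ((u + ‖t‖ * latN p) ^ bs.length * (u + ‖t‖ * latN p)) := by ring

variable {Z : Type*} [MeasurableSpace Z]

/-- **WILSON WORDS INHABIT THE OBSERVABLE HYPOTHESIS OF `weightSlice_dressed` ON THE LATTICE CHART** [decided instance]: for the affine
chart `latMove`∕`latN` of `T4BlockTransport`, a window `𝒦` with bond-wise sup bound `u ≥ 0`, `0 ≤ ϱ`, a word `bs` and a functional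
`φ : R →L[ℂ] ℂ` (e.g. a normalised trace), the `z`-independent observable `U ↦ φ(∏_{b ∈ bs} U b)` is, along EVERY admissible slice
(`0 < latN p ≤ w`), measurable, holomorphic and bounded by `B = ‖φ‖·‖1‖·(u + 2w + ϱ)^{|bs|}` on the open set `{t | ‖t‖ < 2 + ϱ∕latN p}`,
which contains the closed discs of radius `ϱ ∕ latN p` about `[0,1]` (on it `‖t‖·latN p ≤ 2·latN p + ϱ ≤ 2w + ϱ`). [folklore] -/
theorem wilsonWord_alongSlices (bs : List (Site d × Fin d)) (φ : R →L[ℂ] ℂ) (μ : Measure Z)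
    {𝒦 : Set (Fld d R)} {u w ϱ : ℝ} (hu0 : 0 ≤ u) (hu : ∀ U ∈ 𝒦, ∀ x ν, ‖U x ν‖ ≤ u) (hϱ : 0 ≤ ϱ) :
    ∀ U₀ ∈ 𝒦, ∀ p : NDir d R, 0 < latN p → latN p ≤ w →
      ∃ Ω' : Set ℂ, IsOpen Ω' ∧ (∀ x ∈ Icc (0 : ℝ) 1, closedBall (x : ℂ) (ϱ / latN p) ⊆ Ω') ∧
        (∀ t ∈ Ω', AEStronglyMeasurable (fun _ : Z => φ (bs.map fun b => latMove U₀ p t b.1 b.2).prod) μ) ∧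
        (∀ᵐ _z ∂μ, DifferentiableOn ℂ (fun t => φ (bs.map fun b => latMove U₀ p t b.1 b.2).prod) Ω') ∧
        (∀ᵐ _z ∂μ, ∀ t ∈ Ω',
          ‖φ (bs.map fun b => latMove U₀ p t b.1 b.2).prod‖ ≤ ‖φ‖ * ‖(1 : R)‖ * (u + 2 * w + ϱ) ^ bs.length) := by
  intro U₀ hU₀ p hp hpw
  refine ⟨{t : ℂ | ‖t‖ < 2 + ϱ / latN p}, isOpen_lt continuous_norm continuous_const, ?_,
    fun t _ => aestronglyMeasurable_const, Eventually.of_forall fun _ => ?_, Eventually.of_forall fun _ t ht => ?_⟩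
  · intro x hx y hy
    show ‖y‖ < 2 + ϱ / latN p
    have hxy : dist y (x : ℂ) ≤ ϱ / latN p := mem_closedBall.mp hy
    rw [dist_eq_norm] at hxy
    have hx1 : ‖(x : ℂ)‖ ≤ 1 := by
      rw [Complex.norm_real, Real.norm_eq_abs, abs_of_nonneg hx.1]; exact hx.2
    calc ‖y‖ = ‖(y - x) + x‖ := by rw [sub_add_cancel]
      _ ≤ ‖y - (x : ℂ)‖ + ‖(x : ℂ)‖ := norm_add_le _ _
      _ ≤ ϱ / latN p + 1 := add_le_add hxy hx1
      _ < 2 + ϱ / latN p := by linarith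
  · exact (φ.differentiable.comp (differentiable_wordProd bs U₀ p)).differentiableOn
  · have ht' : ‖t‖ < 2 + ϱ / latN p := ht
    have htN : ‖t‖ * latN p ≤ 2 * w + ϱ := by
      have h1 : ‖t‖ * latN p ≤ (2 + ϱ / latN p) * latN p := mul_le_mul_of_nonneg_right ht'.le hp.le
      have h2 : (2 + ϱ / latN p) * latN p = 2 * latN p + ϱ := by field_simp
      linarith [mul_le_mul_of_nonneg_left hpw (by norm_num : (0 : ℝ) ≤ 2)]
    have hc : u + ‖t‖ * latN p ≤ u + 2 * w + ϱ := by linarith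
    have hc0 : 0 ≤ u + ‖t‖ * latN p := add_nonneg hu0 (mul_nonneg (norm_nonneg _) hp.le)
    calc ‖φ (bs.map fun b => latMove U₀ p t b.1 b.2).prod‖
        ≤ ‖φ‖ * ‖(bs.map fun b => latMove U₀ p t b.1 b.2).prod‖ := φ.le_opNorm _
      _ ≤ ‖φ‖ * (‖(1 : R)‖ * (u + ‖t‖ * latN p) ^ bs.length) :=
          mul_le_mul_of_nonneg_left (norm_wordProd_le bs (hu U₀ hU₀) p t) (norm_nonneg _)
      _ ≤ ‖φ‖ * (‖(1 : R)‖ * (u + 2 * w + ϱ) ^ bs.length) := by gcongr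
      _ = ‖φ‖ * ‖(1 : R)‖ * (u + 2 * w + ϱ) ^ bs.length := by ring

/-- **DRESSING BY A WILSON WORD ON THE LATTICE CHART** [decided instance of `weightSlice_dressed`]: a weight slice of margin `s` on
the lattice chart with a bond-wise bounded window, dressed by `e^{τ·φ(∏_{b∈bs} U b)}` with `‖τ‖ ≤ l₀`, is a weight slice of margin
`s + l₀·(‖φ‖·‖1‖·(u + 2w + ϱ)^{|bs|})`. [folklore] -/
theorem weightSlice_dressed_wilsonWord {μ : Measure Z} {ω : Fld d R → Z → ℂ} {𝒦 : Set (Fld d R)} {w ϱ s u l₀ : ℝ}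
    {τ : ℂ} (hws : WeightSlice ω μ latMove latN 𝒦 w ϱ s) (hτ : ‖τ‖ ≤ l₀)
    (hu0 : 0 ≤ u) (hu : ∀ U ∈ 𝒦, ∀ x ν, ‖U x ν‖ ≤ u) (hϱ : 0 ≤ ϱ)
    (bs : List (Site d × Fin d)) (φ : R →L[ℂ] ℂ) :
    WeightSlice (fun U z => ω U z * Complex.exp (τ * φ (bs.map fun b => U b.1 b.2).prod)) μ latMove latN 𝒦 w ϱ
      (s + l₀ * (‖φ‖ * ‖(1 : R)‖ * (u + 2 * w + ϱ) ^ bs.length)) :=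
  weightSlice_dressed (G := fun (U : Fld d R) (_ : Z) => φ (bs.map fun b => U b.1 b.2).prod)
    (B := ‖φ‖ * ‖(1 : R)‖ * (u + 2 * w + ϱ) ^ bs.length) hws hτ fun U₀ hU₀ p hp hpw => by
    obtain ⟨Ω', h1, h2, h3, h4, h5⟩ := wilsonWord_alongSlices bs φ μ hu0 hu hϱ U₀ hU₀ p hp hpw
    exact ⟨Ω', h1, h2, h3, h4, h5⟩

end WilsonWord

end

end YMDAG.N14
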